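import Summits.AtomisticToContinuum.Crystallization.Theorems.TwoCentreKissingKernelRobustTangencyBoundRhombusSystem
import Summits.AtomisticToContinuum.Crystallization.Theorems.TwoCentreKissingKernelRobustTangencyBoundPentagonCert2
import HarnessLib

/-!
# `RobustTangencyBound` — the isolated-pentagon system: the candidate solution and the algebraic
# core (step (III), robust Bezdek–Reid Lemma 5)

Route `TwoCentreKissingKernel`, item `stmt-AtomisticToContinuum-12082`, blueprint (III) §5–7.  The middle layer between the
geometry (`…PentagonIsolated.lean`) and the kernel certificates `pentClaim_holds`
(`…PentagonCert.lean`, `…PentagonCert2.lean`), parallel to `…RhombusSystem.lean`: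

* `pentPt` — the candidate solution: `x₁, x₂, s₁₂, s₂₃, s₃₄, s₄₅, s₅₁`, then the `(cos, sin)` pairs
  of the regular corners at `p₂` (list `L2`), at `p₅` (`L5`), at `p₁` (`L1`); `pentPt_base`,
  `pentPt_blk2/5/1`, `pentPt_mem_pentBox`, `map_zOf_regVars_blk2/5/1`;
* `pent_core_false` — admissible data (windows, unit circles, the three vertex conditions in
  product form) would solve `pentClaim m₂ m₅ m₁` in its box: contradiction.
-/

noncomputable section

namespace Summit.AtomisticToContinuum.Crystallization.Theorems

open Real Literature.Analysis.ValidatedNumerics Finset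

/-- **The candidate solution of the pentagon system.** -/
def pentPt {α : Type*} (x₁ x₂ s₁₂ s₂₃ s₃₄ s₄₅ s₅₁ : ℝ) (L2 L5 L1 : List α)
    (C2 S2 C5 S5 C1 S1 : α → ℝ) : ℕ → ℝ :=
  fun i => ([x₁, x₂, s₁₂, s₂₃, s₃₄, s₄₅, s₅₁] ++ (L2.map fun c => [C2 c, S2 c]).flatten ++
    (L5.map fun c => [C5 c, S5 c]).flatten ++ (L1.map fun c => [C1 c, S1 c]).flatten).getD i 0

section PentPt

variable {α : Type*} (x₁ x₂ s₁₂ s₂₃ s₃₄ s₄₅ s₅₁ : ℝ) (L2 L5 L1 : List α)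
  (C2 S2 C5 S5 C1 S1 : α → ℝ) (d : α)

/-- The first seven coordinates. -/
theorem pentPt_base :
    pentPt x₁ x₂ s₁₂ s₂₃ s₃₄ s₄₅ s₅₁ L2 L5 L1 C2 S2 C5 S5 C1 S1 0 = x₁ ∧
    pentPt x₁ x₂ s₁₂ s₂₃ s₃₄ s₄₅ s₅₁ L2 L5 L1 C2 S2 C5 S5 C1 S1 1 = x₂ ∧
    pentPt x₁ x₂ s₁₂ s₂₃ s₃₄ s₄₅ s₅₁ L2 L5 L1 C2 S2 C5 S5 C1 S1 2 = s₁₂ ∧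
    pentPt x₁ x₂ s₁₂ s₂₃ s₃₄ s₄₅ s₅₁ L2 L5 L1 C2 S2 C5 S5 C1 S1 3 = s₂₃ ∧
    pentPt x₁ x₂ s₁₂ s₂₃ s₃₄ s₄₅ s₅₁ L2 L5 L1 C2 S2 C5 S5 C1 S1 4 = s₃₄ ∧
    pentPt x₁ x₂ s₁₂ s₂₃ s₃₄ s₄₅ s₅₁ L2 L5 L1 C2 S2 C5 S5 C1 S1 5 = s₄₅ ∧
    pentPt x₁ x₂ s₁₂ s₂₃ s₃₄ s₄₅ s₅₁ L2 L5 L1 C2 S2 C5 S5 C1 S1 6 = s₅₁ := by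
  simp [pentPt]

/-- The block of the regular corners at `p₂`. -/
theorem pentPt_blk2 {j : ℕ} (hj : j < L2.length) :
    pentPt x₁ x₂ s₁₂ s₂₃ s₃₄ s₄₅ s₅₁ L2 L5 L1 C2 S2 C5 S5 C1 S1 (7 + 2 * j) = C2 (L2.getD j d) ∧
    pentPt x₁ x₂ s₁₂ s₂₃ s₃₄ s₄₅ s₅₁ L2 L5 L1 C2 S2 C5 S5 C1 S1 (7 + 2 * j + 1) = S2 (L2.getD j d) := by
  have hb : ([x₁, x₂, s₁₂, s₂₃, s₃₄, s₄₅, s₅₁] : List ℝ).length = 7 := by simp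
  have hbl : ((L2.map fun c => [C2 c, S2 c]).flatten).length = 2 * L2.length := length_pairs L2
  constructor
  · simp only [pentPt]
    rw [List.append_assoc, List.append_assoc, List.getD_append_right _ _ _ _ (by rw [hb]; omega), hb,
      show 7 + 2 * j - 7 = 2 * j by omega, List.getD_append _ _ _ _ (by rw [hbl]; omega),
      getD_pairs_even d L2 j hj]
  · simp only [pentPt]
    rw [List.append_assoc, List.append_assoc, List.getD_append_right _ _ _ _ (by rw [hb]; omega), hb,
      show 7 + 2 * j + 1 - 7 = 2 * j + 1 by omega, List.getD_append _ _ _ _ (by rw [hbl]; omega),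
      getD_pairs_odd d L2 j hj]

/-- The block of the regular corners at `p₅`. -/
theorem pentPt_blk5 {j : ℕ} (hj : j < L5.length) :
    pentPt x₁ x₂ s₁₂ s₂₃ s₃₄ s₄₅ s₅₁ L2 L5 L1 C2 S2 C5 S5 C1 S1 (7 + 2 * L2.length + 2 * j) =
      C5 (L5.getD j d) ∧
    pentPt x₁ x₂ s₁₂ s₂₃ s₃₄ s₄₅ s₅₁ L2 L5 L1 C2 S2 C5 S5 C1 S1 (7 + 2 * L2.length + 2 * j + 1) =
      S5 (L5.getD j d) := by
  have hb : (([x₁, x₂, s₁₂, s₂₃, s₃₄, s₄₅, s₅₁] : List ℝ) ++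
      (L2.map fun c => [C2 c, S2 c]).flatten).length = 7 + 2 * L2.length := by
    rw [List.length_append, length_pairs]; simp
  have hbl : ((L5.map fun c => [C5 c, S5 c]).flatten).length = 2 * L5.length := length_pairs L5
  constructor
  · simp only [pentPt]
    rw [List.append_assoc, List.getD_append_right _ _ _ _ (by rw [hb]; omega), hb,
      show 7 + 2 * L2.length + 2 * j - (7 + 2 * L2.length) = 2 * j by omega,
      List.getD_append _ _ _ _ (by rw [hbl]; omega), getD_pairs_even d L5 j hj]
  · simp only [pentPt]
    rw [List.append_assoc, List.getD_append_right _ _ _ _ (by rw [hb]; omega), hb,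
      show 7 + 2 * L2.length + 2 * j + 1 - (7 + 2 * L2.length) = 2 * j + 1 by omega,
      List.getD_append _ _ _ _ (by rw [hbl]; omega), getD_pairs_odd d L5 j hj]

/-- The block of the regular corners at `p₁`. -/
theorem pentPt_blk1 {j : ℕ} (hj : j < L1.length) :
    pentPt x₁ x₂ s₁₂ s₂₃ s₃₄ s₄₅ s₅₁ L2 L5 L1 C2 S2 C5 S5 C1 S1
        (7 + 2 * L2.length + 2 * L5.length + 2 * j) = C1 (L1.getD j d) ∧
    pentPt x₁ x₂ s₁₂ s₂₃ s₃₄ s₄₅ s₅₁ L2 L5 L1 C2 S2 C5 S5 C1 S1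
        (7 + 2 * L2.length + 2 * L5.length + 2 * j + 1) = S1 (L1.getD j d) := by
  have hb : (([x₁, x₂, s₁₂, s₂₃, s₃₄, s₄₅, s₅₁] : List ℝ) ++
      (L2.map fun c => [C2 c, S2 c]).flatten ++ (L5.map fun c => [C5 c, S5 c]).flatten).length =
      7 + 2 * L2.length + 2 * L5.length := by
    rw [List.length_append, List.length_append, length_pairs, length_pairs]
    simp only [List.length_cons, List.length_nil]
  constructor
  · simp only [pentPt]
    rw [List.getD_append_right _ _ _ _ (by rw [hb]; omega), hb,
      show 7 + 2 * L2.length + 2 * L5.length + 2 * j - (7 + 2 * L2.length + 2 * L5.length) = 2 * j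
        by omega, getD_pairs_even d L1 j hj]
  · simp only [pentPt]
    rw [List.getD_append_right _ _ _ _ (by rw [hb]; omega), hb,
      show 7 + 2 * L2.length + 2 * L5.length + 2 * j + 1 - (7 + 2 * L2.length + 2 * L5.length) =
        2 * j + 1 by omega, getD_pairs_odd d L1 j hj]

/-- **The candidate solution lies in the box** when its coordinates lie in their windows. -/
theorem pentPt_mem_pentBox
    (hx₁ : InIvl (((-51 : ℚ)) / 100, (502 : ℚ) / 1000) x₁) (hx₂ : InIvl (((-51 : ℚ)) / 100, (502 : ℚ) / 1000) x₂)
    (h₁ : InIvl ((497 : ℚ) / 1000, (502 : ℚ) / 1000) s₁₂) (h₂ : InIvl ((497 : ℚ) / 1000, (502 : ℚ) / 1000) s₂₃)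
    (h₃ : InIvl ((497 : ℚ) / 1000, (502 : ℚ) / 1000) s₃₄) (h₄ : InIvl ((497 : ℚ) / 1000, (502 : ℚ) / 1000) s₄₅)
    (h₅ : InIvl ((497 : ℚ) / 1000, (502 : ℚ) / 1000) s₅₁)
    (hw2 : ∀ c ∈ L2, InIvl ((3252 : ℚ) / 10000, (3415 : ℚ) / 10000) (C2 c) ∧
      InIvl ((9398 : ℚ) / 10000, (9457 : ℚ) / 10000) (S2 c))
    (hw5 : ∀ c ∈ L5, InIvl ((3252 : ℚ) / 10000, (3415 : ℚ) / 10000) (C5 c) ∧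
      InIvl ((9398 : ℚ) / 10000, (9457 : ℚ) / 10000) (S5 c))
    (hw1 : ∀ c ∈ L1, InIvl ((3252 : ℚ) / 10000, (3415 : ℚ) / 10000) (C1 c) ∧
      InIvl ((9398 : ℚ) / 10000, (9457 : ℚ) / 10000) (S1 c)) :
    Box.mem (pentBox L2.length L5.length L1.length)
      (pentPt x₁ x₂ s₁₂ s₂₃ s₃₄ s₄₅ s₅₁ L2 L5 L1 C2 S2 C5 S5 C1 S1) := by
  apply boxmem_of_forall₂
  rw [pentBox, List.replicate_add, List.replicate_add, List.flatten_append, List.flatten_append,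
    ← List.append_assoc, ← List.append_assoc]
  refine forall₂_append (forall₂_append (forall₂_append ?_ (forall₂_pairs L2 hw2))
    (forall₂_pairs L5 hw5)) (forall₂_pairs L1 hw1)
  simp only [List.replicate, List.cons_append, List.nil_append]
  exact List.Forall₂.cons hx₁ (List.Forall₂.cons hx₂ (List.Forall₂.cons h₁ (List.Forall₂.cons h₂
    (List.Forall₂.cons h₃ (List.Forall₂.cons h₄ (List.Forall₂.cons h₅ List.Forall₂.nil))))))

/-- The regular block at `p₂` of the system evaluates to the given complex numbers. -/
theorem map_zOf_regVars_blk2 :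
    (regVars 7 L2.length).map (zOf (pentPt x₁ x₂ s₁₂ s₂₃ s₃₄ s₄₅ s₅₁ L2 L5 L1 C2 S2 C5 S5 C1 S1)) =
      L2.map fun c => ((C2 c : ℂ) + (S2 c : ℂ) * Complex.I) := by
  apply List.ext_getElem
  · simp [regVars]
  · intro j h1 h2
    have hj : j < L2.length := by simpa [regVars] using h1
    obtain ⟨e1, e2⟩ := pentPt_blk2 x₁ x₂ s₁₂ s₂₃ s₃₄ s₄₅ s₅₁ L2 L5 L1 C2 S2 C5 S5 C1 S1 (L2[j]) hj
    simp only [regVars, List.getElem_map, List.getElem_range, zOf, RExpr.eval]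
    rw [e1, e2, List.getD_eq_getElem _ _ hj]

/-- The regular block at `p₅` of the system evaluates to the given complex numbers. -/
theorem map_zOf_regVars_blk5 :
    (regVars (7 + 2 * L2.length) L5.length).map
        (zOf (pentPt x₁ x₂ s₁₂ s₂₃ s₃₄ s₄₅ s₅₁ L2 L5 L1 C2 S2 C5 S5 C1 S1)) =
      L5.map fun c => ((C5 c : ℂ) + (S5 c : ℂ) * Complex.I) := by
  apply List.ext_getElem
  · simp [regVars]
  · intro j h1 h2
    have hj : j < L5.length := by simpa [regVars] using h1
    obtain ⟨e1, e2⟩ := pentPt_blk5 x₁ x₂ s₁₂ s₂₃ s₃₄ s₄₅ s₅₁ L2 L5 L1 C2 S2 C5 S5 C1 S1 (L5[j]) hj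
    simp only [regVars, List.getElem_map, List.getElem_range, zOf, RExpr.eval]
    rw [e1, e2, List.getD_eq_getElem _ _ hj]

/-- The regular block at `p₁` of the system evaluates to the given complex numbers. -/
theorem map_zOf_regVars_blk1 :
    (regVars (7 + 2 * L2.length + 2 * L5.length) L1.length).map
        (zOf (pentPt x₁ x₂ s₁₂ s₂₃ s₃₄ s₄₅ s₅₁ L2 L5 L1 C2 S2 C5 S5 C1 S1)) =
      L1.map fun c => ((C1 c : ℂ) + (S1 c : ℂ) * Complex.I) := by
  apply List.ext_getElem
  · simp [regVars]
  · intro j h1 h2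
    have hj : j < L1.length := by simpa [regVars] using h1
    obtain ⟨e1, e2⟩ := pentPt_blk1 x₁ x₂ s₁₂ s₂₃ s₃₄ s₄₅ s₅₁ L2 L5 L1 C2 S2 C5 S5 C1 S1 (L1[j]) hj
    simp only [regVars, List.getElem_map, List.getElem_range, zOf, RExpr.eval]
    rw [e1, e2, List.getD_eq_getElem _ _ hj]

end PentPt

/-- **The algebraic core of the pentagon lemma**: no admissible data solve the system. -/
theorem pent_core_false {α : Type*} {x₁ x₂ s₁₂ s₂₃ s₃₄ s₄₅ s₅₁ : ℝ} {L2 L5 L1 : List α}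
    {C2 S2 C5 S5 C1 S1 : α → ℝ} (hm2 : L2.length ≤ 5) (hm5 : L5.length ≤ 5) (hm1 : L1.length ≤ 5)
    (hx₁ : InIvl (((-51 : ℚ)) / 100, (502 : ℚ) / 1000) x₁) (hx₂ : InIvl (((-51 : ℚ)) / 100, (502 : ℚ) / 1000) x₂)
    (h₁ : InIvl ((497 : ℚ) / 1000, (502 : ℚ) / 1000) s₁₂) (h₂ : InIvl ((497 : ℚ) / 1000, (502 : ℚ) / 1000) s₂₃)
    (h₃ : InIvl ((497 : ℚ) / 1000, (502 : ℚ) / 1000) s₃₄) (h₄ : InIvl ((497 : ℚ) / 1000, (502 : ℚ) / 1000) s₄₅)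
    (h₅ : InIvl ((497 : ℚ) / 1000, (502 : ℚ) / 1000) s₅₁)
    (hw2 : ∀ c ∈ L2, InIvl ((3252 : ℚ) / 10000, (3415 : ℚ) / 10000) (C2 c) ∧
      InIvl ((9398 : ℚ) / 10000, (9457 : ℚ) / 10000) (S2 c))
    (hw5 : ∀ c ∈ L5, InIvl ((3252 : ℚ) / 10000, (3415 : ℚ) / 10000) (C5 c) ∧
      InIvl ((9398 : ℚ) / 10000, (9457 : ℚ) / 10000) (S5 c))
    (hw1 : ∀ c ∈ L1, InIvl ((3252 : ℚ) / 10000, (3415 : ℚ) / 10000) (C1 c) ∧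
      InIvl ((9398 : ℚ) / 10000, (9457 : ℚ) / 10000) (S1 c))
    (hc2 : ∀ c ∈ L2, S2 c ^ 2 + C2 c ^ 2 = 1) (hc5 : ∀ c ∈ L5, S5 c ^ 2 + C5 c ^ 2 = 1)
    (hc1 : ∀ c ∈ L1, S1 c ^ 2 + C1 c ^ 2 = 1)
    (hprod2 : zOf (pentPt x₁ x₂ s₁₂ s₂₃ s₃₄ s₄₅ s₅₁ L2 L5 L1 C2 S2 C5 S5 C1 S1) pent2R *
      (L2.map fun c => ((C2 c : ℂ) + (S2 c : ℂ) * Complex.I)).prod = 1)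
    (hprod5 : zOf (pentPt x₁ x₂ s₁₂ s₂₃ s₃₄ s₄₅ s₅₁ L2 L5 L1 C2 S2 C5 S5 C1 S1) pent5R *
      (L5.map fun c => ((C5 c : ℂ) + (S5 c : ℂ) * Complex.I)).prod = 1)
    (hprod1 : zOf (pentPt x₁ x₂ s₁₂ s₂₃ s₃₄ s₄₅ s₅₁ L2 L5 L1 C2 S2 C5 S5 C1 S1) pentA1R *
      (zOf (pentPt x₁ x₂ s₁₂ s₂₃ s₃₄ s₄₅ s₅₁ L2 L5 L1 C2 S2 C5 S5 C1 S1) pentB1R *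
        (zOf (pentPt x₁ x₂ s₁₂ s₂₃ s₃₄ s₄₅ s₅₁ L2 L5 L1 C2 S2 C5 S5 C1 S1) pentC1R *
          (L1.map fun c => ((C1 c : ℂ) + (S1 c : ℂ) * Complex.I)).prod)) = 1) : False := by
  have hmem := pentPt_mem_pentBox x₁ x₂ s₁₂ s₂₃ s₃₄ s₄₅ s₅₁ L2 L5 L1 C2 S2 C5 S5 C1 S1
    hx₁ hx₂ h₁ h₂ h₃ h₄ h₅ hw2 hw5 hw1
  have hre_im : ∀ {q : RExpr × RExpr},
      zOf (pentPt x₁ x₂ s₁₂ s₂₃ s₃₄ s₄₅ s₅₁ L2 L5 L1 C2 S2 C5 S5 C1 S1) q = 1 →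
      q.1.eval (pentPt x₁ x₂ s₁₂ s₂₃ s₃₄ s₄₅ s₅₁ L2 L5 L1 C2 S2 C5 S5 C1 S1) = 1 ∧
      q.2.eval (pentPt x₁ x₂ s₁₂ s₂₃ s₃₄ s₄₅ s₅₁ L2 L5 L1 C2 S2 C5 S5 C1 S1) = 0 := by
    intro q h
    have h1 := congrArg Complex.re h
    have h2 := congrArg Complex.im h
    simp [zOf] at h1 h2
    exact ⟨h1, h2⟩
  have hp2 : zOf (pentPt x₁ x₂ s₁₂ s₂₃ s₃₄ s₄₅ s₅₁ L2 L5 L1 C2 S2 C5 S5 C1 S1)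
      (cprodR ([pent2R] ++ regVars 7 L2.length)) = 1 := by
    rw [zOf_cprodR, List.map_append, List.prod_append, map_zOf_regVars_blk2, List.map_cons,
      List.map_nil, List.prod_cons, List.prod_nil, mul_one]
    exact hprod2
  have hp5 : zOf (pentPt x₁ x₂ s₁₂ s₂₃ s₃₄ s₄₅ s₅₁ L2 L5 L1 C2 S2 C5 S5 C1 S1)
      (cprodR ([pent5R] ++ regVars (7 + 2 * L2.length) L5.length)) = 1 := by
    rw [zOf_cprodR, List.map_append, List.prod_append, map_zOf_regVars_blk5, List.map_cons,
      List.map_nil, List.prod_cons, List.prod_nil, mul_one]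
    exact hprod5
  have hp1 : zOf (pentPt x₁ x₂ s₁₂ s₂₃ s₃₄ s₄₅ s₅₁ L2 L5 L1 C2 S2 C5 S5 C1 S1)
      (cprodR ([pentA1R, pentB1R, pentC1R] ++
        regVars (7 + 2 * L2.length + 2 * L5.length) L1.length)) = 1 := by
    rw [zOf_cprodR, List.map_append, List.prod_append, map_zOf_regVars_blk1, List.map_cons,
      List.map_cons, List.map_cons, List.map_nil, List.prod_cons, List.prod_cons, List.prod_cons,
      List.prod_nil, mul_one]
    simpa only [mul_assoc] using hprod1
  obtain ⟨e1, e2⟩ := hre_im hp2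
  obtain ⟨e3, e4⟩ := hre_im hp5
  obtain ⟨e5, e6⟩ := hre_im hp1
  have hhs : ∀ e ∈ pentHs L2.length L5.length L1.length,
      e.eval (pentPt x₁ x₂ s₁₂ s₂₃ s₃₄ s₄₅ s₅₁ L2 L5 L1 C2 S2 C5 S5 C1 S1) = 0 := by
    intro e he
    simp only [pentHs, List.mem_append] at he
    rcases he with ((hA | hE) | (hB | hE)) | (hC | hE)
    · simp only [regVars, List.map_map, List.mem_map, List.mem_range, Function.comp_apply] at hA
      obtain ⟨j, hj, rfl⟩ := hA
      obtain ⟨f1, f2⟩ := pentPt_blk2 x₁ x₂ s₁₂ s₂₃ s₃₄ s₄₅ s₅₁ L2 L5 L1 C2 S2 C5 S5 C1 S1 (L2[j]) hj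
      simp only [circR, RExpr.eval]
      rw [f1, f2, hc2 _ (by rw [List.getD_eq_getElem _ _ hj]; exact List.getElem_mem hj)]
      push_cast; ring
    · simp only [List.mem_cons, List.mem_nil_iff, or_false] at hE
      rcases hE with rfl | rfl
      · simp only [RExpr.eval]; rw [e1]; push_cast; ring
      · exact e2
    · simp only [regVars, List.map_map, List.mem_map, List.mem_range, Function.comp_apply] at hB
      obtain ⟨j, hj, rfl⟩ := hB
      obtain ⟨f1, f2⟩ := pentPt_blk5 x₁ x₂ s₁₂ s₂₃ s₃₄ s₄₅ s₅₁ L2 L5 L1 C2 S2 C5 S5 C1 S1 (L5[j]) hj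
      simp only [circR, RExpr.eval]
      rw [f1, f2, hc5 _ (by rw [List.getD_eq_getElem _ _ hj]; exact List.getElem_mem hj)]
      push_cast; ring
    · simp only [List.mem_cons, List.mem_nil_iff, or_false] at hE
      rcases hE with rfl | rfl
      · simp only [RExpr.eval]; rw [e3]; push_cast; ring
      · exact e4
    · simp only [regVars, List.map_map, List.mem_map, List.mem_range, Function.comp_apply] at hC
      obtain ⟨j, hj, rfl⟩ := hC
      obtain ⟨f1, f2⟩ := pentPt_blk1 x₁ x₂ s₁₂ s₂₃ s₃₄ s₄₅ s₅₁ L2 L5 L1 C2 S2 C5 S5 C1 S1 (L1[j]) hj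
      simp only [circR, RExpr.eval]
      rw [f1, f2, hc1 _ (by rw [List.getD_eq_getElem _ _ hj]; exact List.getElem_mem hj)]
      push_cast; ring
    · simp only [List.mem_cons, List.mem_nil_iff, or_false] at hE
      rcases hE with rfl | rfl
      · simp only [RExpr.eval]; rw [e5]; push_cast; ring
      · exact e6
  exact pentClaim_holds L2.length L5.length L1.length hm2 hm5 hm1 _ hmem
    ⟨fun g hg => by simp [pentClaim] at hg, hhs⟩

end Summit.AtomisticToContinuum.Crystallization.Theorems

end
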